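import Summits.AtomisticToContinuum.BoseEinsteinCondensation.Theses.BECStronglyRayleigh
import Summits.AtomisticToContinuum.BoseEinsteinCondensation.Theorems.InsertionFieldDelocalisation.Negative.Toolkit
import Summits.AtomisticToContinuum.BoseEinsteinCondensation.Theorems.InsertionFieldDelocalisation.Negative.Tightness
import Summits.AtomisticToContinuum.BoseEinsteinCondensation.Theorems.InsertionFieldDelocalisation.Negative.LoadBearing
import Summits.AtomisticToContinuum.BoseEinsteinCondensation.Theorems.InsertionFieldDelocalisation.Negative.PerronExistence
import Literature.Probability.LatticeModels.LatticeGreenFunction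
import Summits.AtomisticToContinuum.BoseEinsteinCondensation.Theorems.BECStronglyRayleighInsertionFieldDelocalisationThirdMomentReduction
import Summits.AtomisticToContinuum.BoseEinsteinCondensation.Theorems.BECStronglyRayleighInsertionFieldDelocalisationAmplitudePos
import Summits.AtomisticToContinuum.BoseEinsteinCondensation.Theorems.BECStronglyRayleighInsertionFieldDelocalisationLogMeanDomination
import Summits.AtomisticToContinuum.BoseEinsteinCondensation.Theorems.BECStronglyRayleighInsertionFieldDelocalisationGreenIdentities
import Summits.AtomisticToContinuum.BoseEinsteinCondensation.Theorems.BECStronglyRayleighInsertionFieldDelocalisationTorusGreenZeroBounded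
import Summits.AtomisticToContinuum.BoseEinsteinCondensation.Theorems.BECStronglyRayleighInsertionFieldDelocalisationTranslationInvariance
import HarnessLib

/-!
# Line `log-insertion-infrared-bound` — skeleton for crux `BECStronglyRayleigh.InsertionFieldDelocalisation`
(stmt-AtomisticToContinuum-9673, route `route-AtomisticToContinuum-BECStronglyRayleigh`; crux-plan seat
`planner-cruxplan-stmt-AtomisticToContinuum-9673-log-insertion-infrar-0`, 2026-08-16; idea card
`Cruxes/InsertionFieldDelocalisation/Ideas/log-insertion-infrared-bound.md`, triage TRIAGE-r1-{1,2,3}.md: pass ×3).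

## The crux (fixed; route file rev 10)
`InsertionFieldDelocalisation = ∃ M, InsertionFieldDelocalisationAt M` (`insertionFieldDelocalisation_iff`, landed
`Theorems/InsertionFieldDelocalisation/Negative/Toolkit.lean`): for hard-core bosons on `(ℤ/Lℤ)³` (`xyTorus 3 L 1`), every
`L ≥ 2`, `2 ≤ N ≤ L³/2` and every entrywise-nonnegative sector-`N` ground vector `ψ`, with the two-particle insertion
field `r^T = field ψ T` (`|T| = N − 2`; `r^T_x = Σ_y [x,y ∉ T, x ≠ y] Re ψ(1_{T∪{x,y}})`):
`L³ Σ_T K1lhs (r^T) ≤ M Σ_T K1rhs (r^T)`, `K1lhs r = Σr³/Σr + (Σr²)²/(Σr)²`, `K1rhs r = Σr² = ‖r‖²` (the `ω`-weight).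

## The line (card steps (1)–(3), sharpened by the triage panel)
Write `F_T := Tᶜ` (free sites, `n_T := |F_T| = L³ − N + 2 ≥ L³/2`), `R_T := Σ_x r^T_x`, `g_T := log r^T` on `F_T`,
`ḡ_T := n_T⁻¹ Σ_{F_T} g_T` (free-site mean). Four registered stubs and a kernel-checked composition:

* `stub_thirdMomentReduction` (S1 · M · PROVABLE NOW · card (1a)): for every `K`,
  `NormalisedThirdMoment K → InsertionFieldDelocalisationAt (8K)`, where `NormalisedThirdMoment K` says
  `Σ_T ‖r^T‖² · A₃(T) ≤ K Σ_T ‖r^T‖²` with `A₃(T) := n_T⁻¹ Σ_{x ∈ F_T} (n_T r^T_x / R_T)³` (= `avg_F (r/r̄)³`, the arithmetic-mean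
  normalised third moment of the insertion field). Proof: termwise `K1lhs r ≤ 2·L³·(Σr³)(Σr²)/(Σr)³` (Cauchy–Schwarz
  `(Σr)² ≤ L³Σr²` + Chebyshev's sum inequality `(Σr²)(Σr) ≤ L³Σr³`, `r ≥ 0`; both sides `0` when `Σr = 0`, matching `x/0 = 0`),
  i.e. `L³·K1lhs r ≤ 2‖r‖²·L⁶Σr³/R³ = 2‖r‖²·(L³/n_T)²·A₃(T) ≤ 8‖r‖²A₃(T)` because `r^T = 0` on `T` (`field_eq_zero_of_mem`) and
  `(L³/n_T)² ≤ 4 ⟸ 2N ≤ L³` — THIS is where the filling restriction is used (`insertionFieldDelocalisation_false_without_halfFilling`).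
* `stub_amplitudePos` (S2 · M · PROVABLE NOW): Perron–Frobenius POSITIVITY — every admissible `ψ` has `Re ψ(1_S) > 0` on every
  `N`-set `S`. Proof: `ψ` vanishes off the sector (diagonal `S³_tot`); at a zero `N`-set the eigen-equation row reads
  `−½ Σ_{S'∼S} Re ψ(1_{S'}) = 0` (entries: `xxzZero_apply`, landed `Negative/PerronExistence.lean`), so all token-graph neighbours
  vanish; the `N`-token graph of the connected torus graph is connected (`TokenSliding.exists_slide_out`), so `ψ = 0`,
  contradiction. THIS is where `Hψ = E_min ψ` enters the deterministic layer (`insertionFieldDelocalisation_false_without_groundState`: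
  the frozen pair `δ_{1_{ab}}` violates it).
* `stub_logMeanDomination` (S3 · S/M · PROVABLE NOW · card (1b)): for every `K`,
  `AmplitudePos → LogInsertionExpMoment K → NormalisedThirdMoment K`. Proof: `r^T_x ≥ Re ψ(1_{T∪{x,y₀}}) > 0` for `x ∈ F_T`
  (`le_field` + S2, some `y₀ ∈ F_T ∖ {x}` exists as `n_T ≥ 2`), and termwise `(n_T r_x/R_T)³ ≤ exp 3(log r_x − ḡ_T)` ⟺
  `ḡ_T ≤ log (R_T/n_T)` = Jensen for the concave `log` (`R_T/n_T` is the arithmetic mean of `r` over `F_T`; Mathlib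
  `ConcaveOn.le_map_sum` / `Real.inner_le_nnorm_mul_nnorm`-free AM–GM `Real.geom_mean_le_arith_mean_weighted`).
* `stub_logInsertionExpMoment` (S4 · XL · THE BET, lead's stub · card C⁺ restricted as TRIAGE r1-1 (1)/r1-2/r1-3 demand):
  `∃ K, LogInsertionExpMoment K`: the `ω`-average over `T` of the free-site average of `exp 3(g_T(x) − ḡ_T)` is bounded by ONE
  constant — a one-sided, centred third exponential moment of the LOG-insertion field at a uniformly random free site. It is a
  genuine strengthening of the crux (it also controls the geometric/arithmetic-mean ratio of `r^T` over free sites, i.e. the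
  spatial log-variance), with additive structure: `g_T(x) − ḡ_T = ⟨κ_x − avg_{F_T} κ, ∇ĝ_T⟩` for EVERY extension `ĝ_T` of `g_T`
  across `T` (discrete Newtonian potential, kernel `κ_x(y,i) = ½[G(x−y−eᵢ) − G(x−y)]`, `‖κ_x‖² = G(0)/2`, `G = torusGreen`,
  `G(0) ≤ C` iff `d ≥ 3`) — the infrared mechanism of the card is the PROOF PLAN of this stub (toolkit typed below), not a
  hypothesis of the composition.
* `InsertionFieldDelocalisation_of` composes S1–S4 into the crux BY NAME: `⟨8K, S1 K (S3 K S2 S4ₖ)⟩`.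

## Reshape by the line lead (prover-line-stmt-AtomisticToContinuum-9673-0, 2026-08-16); FINAL STATE: closed modulo S4' exactly
All six deterministic stubs are LANDED (S1 p82565, S2 p81786, S3 p82671, G12 p81828, G3 p79555, G4 p81880) and imported below; the only
`sorry` left is the open core S4' `stub_logInsertionExpMoment` (= the crux + a cavity-Harnack obligation; see Lines/log-insertion-infrared-bound.dead.md).
S4 is split at the skeleton level into its deterministic toolkit — G12 `stub_greenIdentities` (Newtonian-potential
representation + kernel Parseval on `(ℤ/Lℤ)³`), G3 `stub_torusGreenZeroBounded` (`torusGreen 0 ≤ C`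
uniformly in `L ≥ 2`, the `d = 3` input), G4 `stub_translationInvariance` (admissible data are translation invariant) —
and the open core S4' `stub_logInsertionExpMoment : G12 → G3 → G4 → ∃ K, LogInsertionExpMoment K`. Seven registered
stubs in all (= `stubs_max`); the composition consumes all seven and still concludes the crux BY NAME.

## Disproof used (`Cruxes/InsertionFieldDelocalisation/Disproof.lean`, cdisprove v3, no kill; landed `Negative/*` imported above)
* `insertionFieldDelocalisation_false_without_groundState` — HONOURED at S2 (positivity fails for the frozen pair) and S4
  (a ground-state expectation); S1, S3 are eigen-equation-free, exactly like the disprover's `K1_ceiling`.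
* `insertionFieldDelocalisation_false_without_halfFilling` — HONOURED at S1, step `(L³/n_T)² ≤ 4`.
* `four_le_const` / `not_insertionFieldDelocalisationAt_of_lt_four` — CONSISTENT: `LogInsertionExpMoment K` forces `K ≥ 1`
  (Jensen: `avg_F e^{3(g−ḡ)} ≥ 1`), so the line outputs `M = 8K ≥ 8 > 4`; no strengthening to `M < 4` anywhere.
* `K1_ceiling` / `K1Ineq_two_mul_cube` (fixed-`L` triviality) — every stub is a uniformity-in-`L` statement; nothing pointwise in `T`.
* No `-- Targets` section exists yet; no landed Negative lemma refutes an instance of S1–S4 (S1–S3 are theorems; S4 is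
  consistent with `const_lower_bound`).

## Toolkit for the S4 prover (typed and elaborated, `sorry`-only, in `Cruxes/InsertionFieldDelocalisation/IdeatorSketch2.lean`,
namespace `…Cruxes.InsertionFieldDelocalisation.Ideator2`; verified by hand by all three triagers; NOT registered here because the
composition does not consume them — the lead may paste them in as extra stubs and re-run `ledger skeleton check`):
  `green_representation (L) [NeZero L] (hL : 2 ≤ L) (g : TorusSite 3 L → ℝ) (x) :
     g x - (∑ y, g y) / (L:ℝ)^3 = (1/2) * ∑ i : Fin 3, ∑ y, (torusGreen (x - y - Pi.single i 1) - torusGreen (x - y)) * (g (y + Pi.single i 1) - g y)`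
  `green_gradient_sq (L) [NeZero L] (hL : 2 ≤ L) :
     ∑ i : Fin 3, ∑ y : TorusSite 3 L, (torusGreen y - torusGreen (y - Pi.single i 1)) ^ 2 = 2 * torusGreen 0`
  `torusGreen_zero_bounded : ∃ C, ∀ L [NeZero L], 2 ≤ L → torusGreen (0 : TorusSite 3 L) ≤ C`
  (tree: `torusGreen_zero_eventually_le`, `torusGreen_zero_nonneg`, `integrable_indicator_inv_dispersion`, `TorusFourier`).

Stub signatures are spelled out over importable declarations only and elaborate under the `open`s below; a stub-worker copies the
signature verbatim into `Theorems/BECStronglyRayleighInsertionFieldDelocalisation<StubName>.lean` with the same imports/opens.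
-/

noncomputable section

open scoped BigOperators
open Literature.MathematicalPhysics.QuantumLattice Literature.Probability.LatticeModels
open Summit.AtomisticToContinuum.BoseEinsteinCondensation.Theorems.InsertionFieldDelocalisation.Negative

set_option linter.dupNamespace false

namespace Summit.AtomisticToContinuum.BoseEinsteinCondensation.Cruxes.InsertionFieldDelocalisation.LogInsertionInfraredBound

/-! ### Named intermediate statements (readable composition; each stub below spells its statement out verbatim) -/

/-- **Arithmetic-mean normalised third moment of the insertion field, `ω`-averaged**:
`Σ_T ‖r^T‖² · A₃(T) ≤ K Σ_T ‖r^T‖²`, `A₃(T) = |Tᶜ|⁻¹ Σ_{x ∈ Tᶜ} (|Tᶜ| r^T_x / R_T)³` (`= avg_{free}(r/r̄)³`; `0` if `R_T = 0`).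
Crux binders verbatim. -/
def NormalisedThirdMoment (K : ℝ) : Prop :=
  ∀ (L : ℕ) [NeZero L], 2 ≤ L → ∀ N : ℕ, 2 ≤ N → 2 * N ≤ L ^ 3 →
    ∀ ψ : TensorIndex (TorusSite 3 L) 2 → ℂ,
      ψ ∈ spinZSector 1 ((N : ℝ) - (L : ℝ) ^ 3 / 2) → ψ ≠ 0 →
      (xyTorus 3 L 1).mulVec ψ =
        ((lowestEnergyInSector 1 (xyTorus 3 L 1) ((N : ℝ) - (L : ℝ) ^ 3 / 2) : ℝ) : ℂ) • ψ →
      (∀ σ, 0 ≤ (ψ σ).re ∧ (ψ σ).im = 0) →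
      ∑ T ∈ (Finset.univ : Finset (TorusSite 3 L)).powersetCard (N - 2),
          K1rhs (field ψ T) *
            ((∑ x ∈ Tᶜ, ((Tᶜ.card : ℝ) * field ψ T x / ∑ y, field ψ T y) ^ 3) / (Tᶜ.card : ℝ)) ≤
        K * ∑ T ∈ (Finset.univ : Finset (TorusSite 3 L)).powersetCard (N - 2), K1rhs (field ψ T)

/-- **Centred third exponential moment of the log-insertion field at a uniform free site, `ω`-averaged**:
`Σ_T ‖r^T‖² · |Tᶜ|⁻¹ Σ_{x ∈ Tᶜ} exp 3(log r^T_x − |Tᶜ|⁻¹Σ_{y ∈ Tᶜ} log r^T_y) ≤ K Σ_T ‖r^T‖²`. Crux binders verbatim.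
(Meaningful when `r^T > 0` on `Tᶜ`, which `AmplitudePos` guarantees; `Real.log 0 = 0` otherwise.) -/
def LogInsertionExpMoment (K : ℝ) : Prop :=
  ∀ (L : ℕ) [NeZero L], 2 ≤ L → ∀ N : ℕ, 2 ≤ N → 2 * N ≤ L ^ 3 →
    ∀ ψ : TensorIndex (TorusSite 3 L) 2 → ℂ,
      ψ ∈ spinZSector 1 ((N : ℝ) - (L : ℝ) ^ 3 / 2) → ψ ≠ 0 →
      (xyTorus 3 L 1).mulVec ψ =
        ((lowestEnergyInSector 1 (xyTorus 3 L 1) ((N : ℝ) - (L : ℝ) ^ 3 / 2) : ℝ) : ℂ) • ψ →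
      (∀ σ, 0 ≤ (ψ σ).re ∧ (ψ σ).im = 0) →
      ∑ T ∈ (Finset.univ : Finset (TorusSite 3 L)).powersetCard (N - 2),
          K1rhs (field ψ T) *
            ((∑ x ∈ Tᶜ, Real.exp (3 * (Real.log (field ψ T x) -
                (∑ y ∈ Tᶜ, Real.log (field ψ T y)) / (Tᶜ.card : ℝ)))) / (Tᶜ.card : ℝ)) ≤
        K * ∑ T ∈ (Finset.univ : Finset (TorusSite 3 L)).powersetCard (N - 2), K1rhs (field ψ T)

/-- **Perron–Frobenius positivity of sector ground amplitudes**: every admissible `ψ` (crux binders verbatim) has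
`Re ψ(1_S) > 0` on every `N`-subset `S` of the torus (occupied = index `0`). -/
def AmplitudePos : Prop :=
  ∀ (L : ℕ) [NeZero L], 2 ≤ L → ∀ N : ℕ, 2 ≤ N → 2 * N ≤ L ^ 3 →
    ∀ ψ : TensorIndex (TorusSite 3 L) 2 → ℂ,
      ψ ∈ spinZSector 1 ((N : ℝ) - (L : ℝ) ^ 3 / 2) → ψ ≠ 0 →
      (xyTorus 3 L 1).mulVec ψ =
        ((lowestEnergyInSector 1 (xyTorus 3 L 1) ((N : ℝ) - (L : ℝ) ^ 3 / 2) : ℝ) : ℂ) • ψ →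
      (∀ σ, 0 ≤ (ψ σ).re ∧ (ψ σ).im = 0) →
      ∀ S : Finset (TorusSite 3 L), S.card = N → 0 < (ψ (fun x => if x ∈ S then 0 else 1)).re

/-! ### The four registered stubs (`sorry` lives only here) -/

-- `stub_thirdMomentReduction`: LANDED — imported from Theorems/BECStronglyRayleighInsertionFieldDelocalisation*.lean (same FQN).

-- `stub_amplitudePos`: LANDED — imported from Theorems/BECStronglyRayleighInsertionFieldDelocalisation*.lean (same FQN).

-- `stub_logMeanDomination`: LANDED — imported from Theorems/BECStronglyRayleighInsertionFieldDelocalisation*.lean (same FQN).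

/-! ### S4 reshaped by the lead (2026-08-16): the deterministic toolkit of the infrared proof plan becomes three
registered stubs (G12, G3, G4) consumed by the open core S4'. -/

/-- **Green identities on the discrete 3-torus** (deterministic, provable now; card steps (2)): for every `L ≥ 2`,
(i) the NEWTONIAN-POTENTIAL REPRESENTATION — every real function on `(ℤ/Lℤ)³` is its mean plus the convolution of
its discrete gradient with the gradient of the mean-zero torus Green function `torusGreen` (Fourier symbol `1/ε(p)`,
`ε(p) = Σᵢ(1 − cos pᵢ)`, so `−Δ torusGreen = 2(δ₀ − L⁻³)`), and (ii) PARSEVAL FOR THE KERNEL — the squared ℓ²-norm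
of the gradient of `torusGreen` is `2 · torusGreen 0`. -/
def GreenIdentities : Prop :=
  ∀ (L : ℕ) [NeZero L], 2 ≤ L →
    (∀ (g : TorusSite 3 L → ℝ) (x : TorusSite 3 L),
      g x - (∑ y, g y) / (L : ℝ) ^ 3 =
        (1 / 2 : ℝ) * ∑ i : Fin 3, ∑ y : TorusSite 3 L,
          (torusGreen (x - y - Pi.single i 1) - torusGreen (x - y)) * (g (y + Pi.single i 1) - g y)) ∧
    (∑ i : Fin 3, ∑ y : TorusSite 3 L, (torusGreen y - torusGreen (y - Pi.single i 1)) ^ 2 =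
      2 * torusGreen (0 : TorusSite 3 L))

/-- **The `d = 3` input** (deterministic, provable now; card step (3)): the torus Green function at the origin,
`torusGreen 0 = L⁻³ Σ_{k≠0} ε(p_k)⁻¹` (`torusGreen_zero_eq`), is bounded uniformly in the side `L ≥ 2` (Jordan:
`ε(p) ≥ (2/π²)‖p‖²_∞` on the folded Brillouin zone, and `Σ_{k≠0} ‖k‖∞⁻² = O(L)` in three dimensions). -/
def TorusGreenZeroBounded : Prop :=
  ∃ C : ℝ, ∀ (L : ℕ) [NeZero L], 2 ≤ L → torusGreen (0 : TorusSite 3 L) ≤ C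

/-- **Translation invariance of admissible data** (deterministic, provable now): an entrywise-nonnegative sector
ground vector of `xyTorus 3 L 1` (crux binders verbatim) is invariant under every lattice translation of the torus
(the Hamiltonian commutes with translations; sector Perron–Frobenius uniqueness `SectorGroundStatePerron_proof` makes the
translate a scalar multiple, and nonnegativity + equal norms force the scalar to be `1`). This is what makes
`E_ω × uniform site` a stationary expectation and gives the free one-step identities `E_w e^{2ζ} = 1`. -/
def TranslationInvariance : Prop :=
  ∀ (L : ℕ) [NeZero L], 2 ≤ L → ∀ N : ℕ, 2 ≤ N → 2 * N ≤ L ^ 3 →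
    ∀ ψ : TensorIndex (TorusSite 3 L) 2 → ℂ,
      ψ ∈ spinZSector 1 ((N : ℝ) - (L : ℝ) ^ 3 / 2) → ψ ≠ 0 →
      (xyTorus 3 L 1).mulVec ψ =
        ((lowestEnergyInSector 1 (xyTorus 3 L 1) ((N : ℝ) - (L : ℝ) ^ 3 / 2) : ℝ) : ℂ) • ψ →
      (∀ σ, 0 ≤ (ψ σ).re ∧ (ψ σ).im = 0) →
      ∀ (a : TorusSite 3 L) (σ : TensorIndex (TorusSite 3 L) 2), ψ (fun x => σ (x + a)) = ψ σ

-- `stub_greenIdentities`: LANDED — imported from Theorems/BECStronglyRayleighInsertionFieldDelocalisation*.lean (same FQN).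

-- `stub_torusGreenZeroBounded`: LANDED — imported from Theorems/BECStronglyRayleighInsertionFieldDelocalisation*.lean (same FQN).

-- `stub_translationInvariance`: LANDED — imported from Theorems/BECStronglyRayleighInsertionFieldDelocalisation*.lean (same FQN).

/-- **S4' · `stub_logInsertionExpMoment` · XL · THE OPEN CORE (lead's stub), reshaped.** Given the deterministic toolkit
(G12 Green identities, G3 bounded `torusGreen 0`, G4 translation invariance), the uniform centred third exponential moment
of the log-insertion field at a uniformly random free site under `ω_T ∝ ‖r^T‖²`:
`∃ K, ∀ L N ψ (crux binders), Σ_T ‖r^T‖²·|Tᶜ|⁻¹Σ_{x∈Tᶜ} e^{3(log r^T_x − ḡ_T)} ≤ K Σ_T ‖r^T‖²`.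
Proof plan: `g_T(x) − ḡ_T = ⟨κ_x − avg_{Tᶜ}κ, ∇ĝ_T⟩` (G12 (i), any extension `ĝ_T`), `‖κ_x‖² = torusGreen 0 / 2 ≤ C/2`
(G12 (ii) + G3), stationarity of `ω × site` and the free one-step identities `E_w e^{2ζ} = 1` (G4), and the OPEN step:
sub-Gaussian upper tail of the linear statistic `⟨κ_x − avg κ, ζ⟩` under `ω` with an `L`-independent variance proxy
(a concentration inequality for a local gradient field under a gapless ground-state measure; needs screening of the
log-insertion response). Why it might fail: it implies lattice BEC at every filling `≤ ½` (open, LSSY2005 Ch. 11) and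
additionally bounds the spatial log-variance of `r^T`; `d = 1` analogue is false (`G(0) ≍ L`). Necessarily `K ≥ 1`. -/
theorem stub_logInsertionExpMoment :
    (∀ (L : ℕ) [NeZero L], 2 ≤ L →
      (∀ (g : TorusSite 3 L → ℝ) (x : TorusSite 3 L),
        g x - (∑ y, g y) / (L : ℝ) ^ 3 =
          (1 / 2 : ℝ) * ∑ i : Fin 3, ∑ y : TorusSite 3 L,
            (torusGreen (x - y - Pi.single i 1) - torusGreen (x - y)) * (g (y + Pi.single i 1) - g y)) ∧
      (∑ i : Fin 3, ∑ y : TorusSite 3 L, (torusGreen y - torusGreen (y - Pi.single i 1)) ^ 2 =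
        2 * torusGreen (0 : TorusSite 3 L))) →
    (∃ C : ℝ, ∀ (L : ℕ) [NeZero L], 2 ≤ L → torusGreen (0 : TorusSite 3 L) ≤ C) →
    (∀ (L : ℕ) [NeZero L], 2 ≤ L → ∀ N : ℕ, 2 ≤ N → 2 * N ≤ L ^ 3 →
      ∀ ψ : TensorIndex (TorusSite 3 L) 2 → ℂ,
        ψ ∈ spinZSector 1 ((N : ℝ) - (L : ℝ) ^ 3 / 2) → ψ ≠ 0 →
        (xyTorus 3 L 1).mulVec ψ =
          ((lowestEnergyInSector 1 (xyTorus 3 L 1) ((N : ℝ) - (L : ℝ) ^ 3 / 2) : ℝ) : ℂ) • ψ →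
        (∀ σ, 0 ≤ (ψ σ).re ∧ (ψ σ).im = 0) →
        ∀ (a : TorusSite 3 L) (σ : TensorIndex (TorusSite 3 L) 2), ψ (fun x => σ (x + a)) = ψ σ) →
    ∃ K : ℝ,
      ∀ (L : ℕ) [NeZero L], 2 ≤ L → ∀ N : ℕ, 2 ≤ N → 2 * N ≤ L ^ 3 →
        ∀ ψ : TensorIndex (TorusSite 3 L) 2 → ℂ,
          ψ ∈ spinZSector 1 ((N : ℝ) - (L : ℝ) ^ 3 / 2) → ψ ≠ 0 →
          (xyTorus 3 L 1).mulVec ψ =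
            ((lowestEnergyInSector 1 (xyTorus 3 L 1) ((N : ℝ) - (L : ℝ) ^ 3 / 2) : ℝ) : ℂ) • ψ →
          (∀ σ, 0 ≤ (ψ σ).re ∧ (ψ σ).im = 0) →
          ∑ T ∈ (Finset.univ : Finset (TorusSite 3 L)).powersetCard (N - 2),
              K1rhs (field ψ T) *
                ((∑ x ∈ Tᶜ, Real.exp (3 * (Real.log (field ψ T x) -
                    (∑ y ∈ Tᶜ, Real.log (field ψ T y)) / (Tᶜ.card : ℝ)))) / (Tᶜ.card : ℝ)) ≤
            K * ∑ T ∈ (Finset.univ : Finset (TorusSite 3 L)).powersetCard (N - 2), K1rhs (field ψ T) := by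
  sorry

/-! ### Consistency: each named statement IS its registered stub (definitionally) -/

theorem thirdMomentReduction_holds :
    ∀ K : ℝ, NormalisedThirdMoment K → InsertionFieldDelocalisationAt (8 * K) :=
  stub_thirdMomentReduction
theorem amplitudePos_holds : AmplitudePos := stub_amplitudePos
theorem logMeanDomination_holds :
    ∀ K : ℝ, AmplitudePos → LogInsertionExpMoment K → NormalisedThirdMoment K :=
  stub_logMeanDomination
theorem greenIdentities_holds : GreenIdentities := stub_greenIdentities
theorem torusGreenZeroBounded_holds : TorusGreenZeroBounded := stub_torusGreenZeroBounded
theorem translationInvariance_holds : TranslationInvariance := stub_translationInvariance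
theorem logInsertionExpMoment_holds :
    GreenIdentities → TorusGreenZeroBounded → TranslationInvariance → ∃ K : ℝ, LogInsertionExpMoment K :=
  stub_logInsertionExpMoment

/-! ### Name-keyed aliases of the seven statements (the hypotheses of the composition; the skeleton audit admits a
hypothesis only if its head constant is a registered obligation or is named like a declared stub) -/
namespace Registered

/-- Alias of S1's statement keyed by the registered stub name. -/
abbrev stub_thirdMomentReduction : Prop :=
  ∀ K : ℝ, NormalisedThirdMoment K → InsertionFieldDelocalisationAt (8 * K)
/-- Alias of S2's statement keyed by the registered stub name. -/
abbrev stub_amplitudePos : Prop := AmplitudePos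
/-- Alias of S3's statement keyed by the registered stub name. -/
abbrev stub_logMeanDomination : Prop :=
  ∀ K : ℝ, AmplitudePos → LogInsertionExpMoment K → NormalisedThirdMoment K
/-- Alias of G12's statement keyed by the registered stub name. -/
abbrev stub_greenIdentities : Prop := GreenIdentities
/-- Alias of G3's statement keyed by the registered stub name. -/
abbrev stub_torusGreenZeroBounded : Prop := TorusGreenZeroBounded
/-- Alias of G4's statement keyed by the registered stub name. -/
abbrev stub_translationInvariance : Prop := TranslationInvariance
/-- Alias of S4''s statement keyed by the registered stub name. -/
abbrev stub_logInsertionExpMoment : Prop :=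
  GreenIdentities → TorusGreenZeroBounded → TranslationInvariance → ∃ K : ℝ, LogInsertionExpMoment K

end Registered

/-! ### The composition (kernel-checked, no `sorry`): S1–S3, G12, G3, G4, S4' ⟹ the crux BY NAME -/

/-- **`InsertionFieldDelocalisation_of`**: the seven registered stubs imply the crux
`Summit.AtomisticToContinuum.BoseEinsteinCondensation.Theses.BECStronglyRayleigh.InsertionFieldDelocalisation`, with
`M = 8K` for the constant `K` of S4': `S4'(G12, G3, G4) ⟹(S3, using S2) NormalisedThirdMoment K ⟹(S1)
InsertionFieldDelocalisationAt (8K)`. -/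
theorem InsertionFieldDelocalisation_of
    (h₁ : Registered.stub_thirdMomentReduction) (h₂ : Registered.stub_amplitudePos)
    (h₃ : Registered.stub_logMeanDomination) (h₅ : Registered.stub_greenIdentities)
    (h₆ : Registered.stub_torusGreenZeroBounded) (h₇ : Registered.stub_translationInvariance)
    (h₄ : Registered.stub_logInsertionExpMoment) :
    Summit.AtomisticToContinuum.BoseEinsteinCondensation.Theses.BECStronglyRayleigh.InsertionFieldDelocalisation := by
  obtain ⟨K, hK⟩ := h₄ h₅ h₆ h₇
  exact insertionFieldDelocalisation_iff.mpr ⟨8 * K, h₁ K (h₃ K h₂ hK)⟩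

/-- Wiring check: the registered stubs feed `InsertionFieldDelocalisation_of` exactly as stated. -/
example : Summit.AtomisticToContinuum.BoseEinsteinCondensation.Theses.BECStronglyRayleigh.InsertionFieldDelocalisation :=
  InsertionFieldDelocalisation_of stub_thirdMomentReduction stub_amplitudePos stub_logMeanDomination
    stub_greenIdentities stub_torusGreenZeroBounded stub_translationInvariance stub_logInsertionExpMoment

/-- Calibration against the disprover's tightness lemma (landed `Negative/Tightness.lean`): whatever constant `K` S4' delivers,
the crux constant `8K` produced by this line is at least `4`, i.e. `K ≥ ½` — consistent with the intrinsic `K ≥ 1`. -/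
example (K : ℝ) (h₁ : Registered.stub_thirdMomentReduction) (hK : NormalisedThirdMoment K) : (1 / 2 : ℝ) ≤ K := by
  have h := four_le_const (h₁ K hK)
  linarith

end Summit.AtomisticToContinuum.BoseEinsteinCondensation.Cruxes.InsertionFieldDelocalisation.LogInsertionInfraredBound

end
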